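import Summits.HodgeConjecture.HodgeConjecture.Theorems.H413E2SWEisDecompositionCM
import Literature.NumberTheory.Weil1965.AdelicSiegelFunctionalLinear
import HarnessLib

/-!
# H413 · E-2 · SW2 — the (E_X) STRUCTURE junction: `E(Ψ) = Ψ♮(0) + E_X(Ψ♮)` with the ℂ-linear Eisenstein functional, unconditionally

Crux `stmt-HodgeConjecture-24833`; child line `Cruxes/H413/Lines/F0_E2SiegelWeilWeilRange.lean`, `stub_SW2iii_siegelWeil`; letters (E_X) of the
Borel-bound sheet v1 §B (`EE, hEE, hEEmono`; consumer ★-track `Theorems/H413E2SWBorelBoundNarrowC`, F0P4-p07 (g3)) and `hE`∕`S_E` of the I-CLOSE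
outer assembly (T1) (`Theorems/H413E2SWIdentityClose`, B-p03 (g23)).  No stub is closed here.  KERNEL MATHEMATICS ONLY (theorems; no definition,
no `sorry`).  Thin junction over ★ `Theorems/H413E2SWEisFourierSide` (B-p02: `E(Ψ) = Ψ♮(0) + Σ'_ξ F*_{Ψ♮}(ξ)` under `hsum`), ★
`Theorems/H413E2SWEisDecompositionCM` (F0P4-p06: `hsum` discharged for a totally real `F`; `isSymm_C0`, `det_C0_ne_zero`, `four_lt_card`,
`hB_C0`) and ★ `Literature/NumberTheory/Weil1965/AdelicSiegelFunctionalLinear` (the ℂ-linear `E_X = adelicSiegelFunctionalC`, its Fourier-side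
bound `hEE` and monotonicity `hEEmono`):

* `eis_eq_geomFrame_zero_add_adelicSiegelFunctionalC` — **`eis … Ψ = Ψ♮(0) + adelicSiegelFunctionalC ν q_{C₀} … hB (geomFrame Ψ)`** for every
  `Ψ ∈ 𝒮(X□)` and any proof `hB` of condition (B) (e.g. ★ `hB_C0`), `F` totally real, `2 < N` — the (T1) letter `hE` with `S_E := adelicSiegelFunctionalC …`;
* `hEE_C0`, `hEEmono_C0` — the sheet's `hEE`, `hEEmono` for `EE := adelicSiegelFunctionalC ν q_{C₀} (continuous_sdForm …) hB` UNCONDITIONALLY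
  (`isSymm_C0`, `det_C0_ne_zero`, `four_lt_card` fed to ★ `enorm_adelicSiegelFunctionalC_sdForm_le_tsum_integral_chirp` ∕ `…_sdForm_mono`).

HC_CM is proved only modulo the 7 printed citations until rung 0 closes; nothing here is about Hodge classes.

References: A. Weil, *Sur la formule de Siegel dans la théorie des groupes classiques*, Acta Math. 113 (1965), Chap. IV n° 41 (34)–(35) p. 59,
Chap. V n° 48 Lemme 21 p. 68 [Weil1965].
-/

set_option autoImplicit false

noncomputable section

open scoped Matrix ENNReal
open NumberField MeasureTheory
open Literature.RepresentationTheory.HeisenbergGroup Literature.RepresentationTheory.HeisenbergGroup.SymplecticMatrix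
open Literature.NumberTheory.Weil1964 Literature.NumberTheory.Weil1965 Literature.NumberTheory.Automorphic
open Literature.NumberTheory.GelbartRogawski1991 Literature.NumberTheory.GelbartRogawski1991.UnitaryDualPair
open Summit.HodgeConjecture.HodgeConjecture.Cruxes.H413

set_option linter.dupNamespace false

namespace Summit.HodgeConjecture.HodgeConjecture.Cruxes.H413.E2SWEisStructure

/-- **THE (T1) LETTER `hE`: `E(Ψ) = Ψ♮(0) + E_X(Ψ♮)`** with the ℂ-LINEAR Eisenstein functional `E_X = adelicSiegelFunctionalC ν q_{C₀}` (★
`AdelicSiegelFunctionalLinear`), for every `Ψ ∈ 𝒮(X□)`, `F` totally real, `2 < N`, any proof `hB` of condition (B) — ★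
`E2SWEisFourierSide.eis_eq_geomFrame_zero_add_tsum_siegelCoeff` with `hsum` discharged (★ `summable_eisSection_of_isTotallyReal`).
[cite: Weil1965, Chap. IV n° 41, (34)–(35) p. 59] [cite: Weil1965, n° 46 p. 66] -/
theorem eis_eq_geomFrame_zero_add_adelicSiegelFunctionalC (F E : Type) [Field F] [NumberField F] [Field E] [NumberField E] [Algebra F E]
    (c : E ≃ₐ[F] E) (N : ℕ) {n : ℕ} (e : Fin N × Fin 1 ≃ Fin n)
    {TV : Matrix (Fin N) (Fin N) F} {TW : Matrix (Fin 1) (Fin 1) F}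
    [Algebra.IsQuadraticExtension F E] [IsTotallyReal F] {δ : E} (hcδ : c δ = -δ) (hδ : δ ≠ 0) {d : F}
    (hd : δ * δ = algebraMap F E d) (hV : TV.IsSymm) (hW : TW.IsSymm) (hVd : IsUnit TV.det) (hWd : IsUnit TW.det)
    [LocallyCompactSpace (UnitaryGroup.adelic F E c N (TV.map (algebraMap F E)))]
    [LocallyCompactSpace (UnitaryGroup.adelic F E c 1 (TW.map (algebraMap F E)))]
    (s : UnitaryGroup.adelicPair F E c N 1 (TV.map (algebraMap F E)) (TW.map (algebraMap F E)) →*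
      adelicMpCont F (Fin n) (adelicGram F e TV TW))
    (hs : (splittingDatum F E c N 1 e (TV.map (algebraMap F E)) (TW.map (algebraMap F E)) hcδ hδ hd hV hW hVd hWd rfl rfl).IsCompatible s)
    (hN : 2 < N)
    [MeasurableSpace (adeleQuotient F)] [BorelSpace (adeleQuotient F)]
    [MeasurableSpace (AdeleRing (𝓞 F) F)] [BorelSpace (AdeleRing (𝓞 F) F)] (ν : Measure (Fin (n + n) → (AdeleRing (𝓞 F) F))) [ν.IsAddHaarMeasure]
    (hν : ν (piFundamentalDomain F (Fin (n + n))) = 1)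
    (hB : ∀ Φ ∈ piSchwartzBruhat F (Fin (n + n)),
      Summable fun ξ : F => ‖adelicSiegelCoeff F (Fin (n + n)) ν (sdForm F (Literature.NumberTheory.Weil1964.ratMatrix F (Matrix.reindex finSumFinEquiv finSumFinEquiv (Matrix.fromBlocks (gram F e TV TW) 0 0 (-(d • (gram F e TV TW)⁻¹)))))) Φ ξ‖)
    (Ψ : piSchwartzBruhat F (Fin (n + n))) :
    ∑' q : (((symplecticGroup (polar (adelicForm F (Fin (n + n)) (adelicGram F (((Equiv.prodCongr (Equiv.refl (Fin N)) finSumFinEquiv.symm).trans (Equiv.prodSumDistrib (Fin N) (Fin 1) (Fin 1))).trans ((Equiv.sumCongr e e).trans finSumFinEquiv)) TV (Matrix.reindex finSumFinEquiv finSumFinEquiv (Matrix.fromBlocks TW 0 0 (-TW))))))).subtype.comp ((toSp F E c N (1 + 1) (((Equiv.prodCongr (Equiv.refl (Fin N)) finSumFinEquiv.symm).trans (Equiv.prodSumDistrib (Fin N) (Fin 1) (Fin 1))).trans ((Equiv.sumCongr e e).trans finSumFinEquiv)) (TV.map (algebraMap F E)) ((Matrix.reindex finSumFinEquiv finSumFinEquiv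 (Matrix.fromBlocks TW 0 0 (-TW))).map (algebraMap F E)) hcδ hδ hd hV (E2SWOrbit.twd_isSymm F TW hW) rfl rfl).comp ((UnitaryGroup.adelicInr F E c N (1 + 1) (TV.map (algebraMap F E)) ((Matrix.reindex finSumFinEquiv finSumFinEquiv (Matrix.fromBlocks TW 0 0 (-TW))).map (algebraMap F E))).comp (UnitaryGroup.toAdelic F E c (1 + 1) ((Matrix.reindex finSumFinEquiv finSumFinEquiv (Matrix.fromBlocks TW 0 0 (-TW))).map (algebraMap F E)))))).range.comap ((symplecticGroup (polar (adelicForm F (Fin (n + n)) (doubledGramFin F (adelicGram F e TV TW))))).subtype.comp (ratSp F (doubledGramFin F (adelicGram F e TV TW)) (isUnit_det_doubledGramFin F _ (isUnit_det_adelicGram F e hVd hWd))))) ⧸ (((siegelParabolicPi (doubledGramFin F (adelicGram F e TV TW))).comap (ratSp F (doubledGramFin F (adelicGram F e TV TW)) (isUnit_det_doubledGramFin F _ (isUnit_det_adelicGram F e hVd hWd)))).comap (MulAut.conj (doublingDeltaRat F (n := n))).toMonoidHom).subgroupOf (((symplecticGroup (polar (adelicForm F (Fin (n + n)) (adelicGram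 F (((Equiv.prodCongr (Equiv.refl (Fin N)) finSumFinEquiv.symm).trans (Equiv.prodSumDistrib (Fin N) (Fin 1) (Fin 1))).trans ((Equiv.sumCongr e e).trans finSumFinEquiv)) TV (Matrix.reindex finSumFinEquiv finSumFinEquiv (Matrix.fromBlocks TW 0 0 (-TW))))))).subtype.comp ((toSp F E c N (1 + 1) (((Equiv.prodCongr (Equiv.refl (Fin N)) finSumFinEquiv.symm).trans (Equiv.prodSumDistrib (Fin N) (Fin 1) (Fin 1))).trans ((Equiv.sumCongr e e).trans finSumFinEquiv)) (TV.map (algebraMap F E)) ((Matrix.reindex finSumFinEquiv finSumFinEquiv (Matrix.fromBlocks TW 0 0 (-TW))).map (algebraMap F E)) hcδ hδ hd hV (E2SWOrbit.twd_isSymm F TW hW) rfl rfl).comp ((UnitaryGroup.adelicInr F E c N (1 + 1) (TV.map (algebraMap F E)) ((Matrix.reindex finSumFinEquiv finSumFinEquiv (Matrix.fromBlocks TW 0 0 (-TW))).map (algebraMap F E))).comp (UnitaryGroup.toAdelic F E c (1 + 1) ((Matrix.reindex finSumFinEquiv finSumFinEquiv (Matrix.fromBlocks TW 0 0 (-TW))).map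 (algebraMap F E)))))).range.comap ((symplecticGroup (polar (adelicForm F (Fin (n + n)) (doubledGramFin F (adelicGram F e TV TW))))).subtype.comp (ratSp F (doubledGramFin F (adelicGram F e TV TW)) (isUnit_det_doubledGramFin F _ (isUnit_det_adelicGram F e hVd hWd))))),
        ((adelicMpCont.omega F (Fin (n + n)) (doubledGramFin F (adelicGram F e TV TW)) (doublingDeltaLift F (adelicGram F e TV TW) (isUnit_det_adelicGram F e hVd hWd)) (adelicMpCont.omega F (Fin (n + n)) (doubledGramFin F (adelicGram F e TV TW)) (ratThetaLiftCont F (doubledGramFin F (adelicGram F e TV TW)) (isUnit_det_doubledGramFin F _ (isUnit_det_adelicGram F e hVd hWd)) ((Quotient.out q : (((symplecticGroup (polar (adelicForm F (Fin (n + n)) (adelicGram F (((Equiv.prodCongr (Equiv.refl (Fin N)) finSumFinEquiv.symm).trans (Equiv.prodSumDistrib (Fin N) (Fin 1) (Fin 1))).trans ((Equiv.sumCongr e e).trans finSumFinEquiv)) TV (Matrix.reindex finSumFinEquiv finSumFinEquiv (Matrix.fromBlocks TW 0 0 (-TW))))))).subtype.comp ((toSp F E c N (1 + 1) (((Equiv.prodCongr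 (Equiv.refl (Fin N)) finSumFinEquiv.symm).trans (Equiv.prodSumDistrib (Fin N) (Fin 1) (Fin 1))).trans ((Equiv.sumCongr e e).trans finSumFinEquiv)) (TV.map (algebraMap F E)) ((Matrix.reindex finSumFinEquiv finSumFinEquiv (Matrix.fromBlocks TW 0 0 (-TW))).map (algebraMap F E)) hcδ hδ hd hV (E2SWOrbit.twd_isSymm F TW hW) rfl rfl).comp ((UnitaryGroup.adelicInr F E c N (1 + 1) (TV.map (algebraMap F E)) ((Matrix.reindex finSumFinEquiv finSumFinEquiv (Matrix.fromBlocks TW 0 0 (-TW))).map (algebraMap F E))).comp (UnitaryGroup.toAdelic F E c (1 + 1) ((Matrix.reindex finSumFinEquiv finSumFinEquiv (Matrix.fromBlocks TW 0 0 (-TW))).map (algebraMap F E)))))).range.comap ((symplecticGroup (polar (adelicForm F (Fin (n + n)) (doubledGramFin F (adelicGram F e TV TW))))).subtype.comp (ratSp F (doubledGramFin F (adelicGram F e TV TW)) (isUnit_det_doubledGramFin F _ (isUnit_det_adelicGram F e hVd hWd)))))) : Matrix.symplecticGroup (Fin (n + n)) F)⁻¹) Ψ) :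
          piSchwartzBruhat F (Fin (n + n))) : (Fin (n + n) → (AdeleRing (𝓞 F) F)) → ℂ) 0 =
      (((geomFrame F (adelicGram F e TV TW) (isUnit_det_adelicGram F e hVd hWd) Ψ : piSchwartzBruhat F (Fin (n + n)))) : (Fin (n + n) → (AdeleRing (𝓞 F) F)) → ℂ) 0 +
        adelicSiegelFunctionalC F (Fin (n + n)) ν (sdForm F (Literature.NumberTheory.Weil1964.ratMatrix F (Matrix.reindex finSumFinEquiv finSumFinEquiv (Matrix.fromBlocks (gram F e TV TW) 0 0 (-(d • (gram F e TV TW)⁻¹))))))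
          (E2SWEisDecomposition.continuous_sdForm F _) hB
          (geomFrame F (adelicGram F e TV TW) (isUnit_det_adelicGram F e hVd hWd) Ψ) :=
  (E2SWEisFourierSide.eis_eq_geomFrame_zero_add_tsum_siegelCoeff F E c N e hcδ hδ hd hV hW hVd hWd s hs hN ν hν Ψ
    (E2SWEisDecompositionCM.summable_eisSection_of_isTotallyReal F E c N e hcδ hδ hd hV hW hVd hWd s hs hN ν hν Ψ)).trans rfl

/-- **`hEE` at `C₀`** (the Borel-bound sheet's Fourier-side letter for `EE := adelicSiegelFunctionalC ν q_{C₀} … hB`):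
`‖EE Φ‖ₑ ≤ Σ'_ξ ‖∫ chirp(ξ • C₀) Φ dν‖ₑ`. [cite: Weil1965, Chap. V n° 48, Lemme 21, p. 68] -/
theorem hEE_C0 (F : Type) [Field F] [NumberField F] {N n : ℕ}
    (e : Fin N × Fin 1 ≃ Fin n) {TV : Matrix (Fin N) (Fin N) F} {TW : Matrix (Fin 1) (Fin 1) F} (d : F)
    [MeasurableSpace (adeleQuotient F)] [BorelSpace (adeleQuotient F)]
    [MeasurableSpace (AdeleRing (𝓞 F) F)] [BorelSpace (AdeleRing (𝓞 F) F)] (ν : Measure (Fin (n + n) → (AdeleRing (𝓞 F) F))) [ν.IsAddHaarMeasure]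
    (hB : ∀ Φ ∈ piSchwartzBruhat F (Fin (n + n)),
      Summable fun ξ : F => ‖adelicSiegelCoeff F (Fin (n + n)) ν (sdForm F (Literature.NumberTheory.Weil1964.ratMatrix F (Matrix.reindex finSumFinEquiv finSumFinEquiv (Matrix.fromBlocks (gram F e TV TW) 0 0 (-(d • (gram F e TV TW)⁻¹)))))) Φ ξ‖)
    (Φ : piSchwartzBruhat F (Fin (n + n))) :
    (‖adelicSiegelFunctionalC F (Fin (n + n)) ν (sdForm F (Literature.NumberTheory.Weil1964.ratMatrix F (Matrix.reindex finSumFinEquiv finSumFinEquiv (Matrix.fromBlocks (gram F e TV TW) 0 0 (-(d • (gram F e TV TW)⁻¹))))))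
        (E2SWEisDecomposition.continuous_sdForm F _) hB Φ‖ₑ : ℝ≥0∞) ≤
      ∑' ξ : F, (‖∫ x, chirp F ((algebraMap F (AdeleRing (𝓞 F) F) ξ) • Literature.NumberTheory.Weil1964.ratMatrix F (Matrix.reindex finSumFinEquiv finSumFinEquiv (Matrix.fromBlocks (gram F e TV TW) 0 0 (-(d • (gram F e TV TW)⁻¹)))))
        ((Φ : piSchwartzBruhat F (Fin (n + n))) : (Fin (n + n) → AdeleRing (𝓞 F) F) → ℂ) x ∂ν‖ₑ : ℝ≥0∞) :=
  enorm_adelicSiegelFunctionalC_sdForm_le_tsum_integral_chirp F ν _ (E2SWEisDecomposition.continuous_sdForm F _) hB Φ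

/-- **`hEEmono` at `C₀`, UNCONDITIONALLY** (`F` totally real, `2 < N`): `‖Φ‖ ≤ Re Ψ` pointwise ⇒ `‖EE Φ‖ₑ ≤ ‖EE Ψ‖ₑ` for
`EE := adelicSiegelFunctionalC ν q_{C₀} … hB` — positivity of the tempered MEASURE `E_X`. [cite: Weil1965, Chap. IV n° 41, (35) p. 59] -/
theorem hEEmono_C0 (F E : Type) [Field F] [NumberField F] [IsTotallyReal F] [Field E] [Algebra F E] {N n : ℕ}
    (e : Fin N × Fin 1 ≃ Fin n) {TV : Matrix (Fin N) (Fin N) F} {TW : Matrix (Fin 1) (Fin 1) F} (hV : TV.IsSymm) (hW : TW.IsSymm)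
    (hVd : IsUnit TV.det) (hWd : IsUnit TW.det) {δ : E} (hδ : δ ≠ 0) {d : F} (hd : δ * δ = algebraMap F E d) (hN : 2 < N)
    [MeasurableSpace (adeleQuotient F)] [BorelSpace (adeleQuotient F)]
    [MeasurableSpace (AdeleRing (𝓞 F) F)] [BorelSpace (AdeleRing (𝓞 F) F)] (ν : Measure (Fin (n + n) → (AdeleRing (𝓞 F) F))) [ν.IsAddHaarMeasure]
    (hB : ∀ Φ ∈ piSchwartzBruhat F (Fin (n + n)),
      Summable fun ξ : F => ‖adelicSiegelCoeff F (Fin (n + n)) ν (sdForm F (Literature.NumberTheory.Weil1964.ratMatrix F (Matrix.reindex finSumFinEquiv finSumFinEquiv (Matrix.fromBlocks (gram F e TV TW) 0 0 (-(d • (gram F e TV TW)⁻¹)))))) Φ ξ‖)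
    (Φ Ψ : piSchwartzBruhat F (Fin (n + n)))
    (hle : ∀ x, ‖(Φ : (Fin (n + n) → AdeleRing (𝓞 F) F) → ℂ) x‖ ≤ (((Ψ : (Fin (n + n) → AdeleRing (𝓞 F) F) → ℂ) x).re)) :
    (‖adelicSiegelFunctionalC F (Fin (n + n)) ν (sdForm F (Literature.NumberTheory.Weil1964.ratMatrix F (Matrix.reindex finSumFinEquiv finSumFinEquiv (Matrix.fromBlocks (gram F e TV TW) 0 0 (-(d • (gram F e TV TW)⁻¹))))))
        (E2SWEisDecomposition.continuous_sdForm F _) hB Φ‖ₑ : ℝ≥0∞) ≤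
      ‖adelicSiegelFunctionalC F (Fin (n + n)) ν (sdForm F (Literature.NumberTheory.Weil1964.ratMatrix F (Matrix.reindex finSumFinEquiv finSumFinEquiv (Matrix.fromBlocks (gram F e TV TW) 0 0 (-(d • (gram F e TV TW)⁻¹))))))
        (E2SWEisDecomposition.continuous_sdForm F _) hB Ψ‖ₑ :=
  enorm_adelicSiegelFunctionalC_sdForm_mono F ν _ (E2SWEisDecomposition.continuous_sdForm F _) hB
    (E2SWEisDecompositionCM.four_lt_card e hN) (E2SWEisDecompositionCM.isSymm_C0 F e hV hW d)
    (E2SWEisDecompositionCM.det_C0_ne_zero F E e hVd hWd hδ hd) Φ Ψ hle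

end Summit.HodgeConjecture.HodgeConjecture.Cruxes.H413.E2SWEisStructure

end
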